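import Literature.NumberTheory.Transcendental.CurvePeriodsEllipticPathsHolds
import Literature.NumberTheory.Transcendental.OnePeriodsProofs
import Literature.NumberTheory.EllipticCurves.SingularModuliIntegralCM
import Literature.NumberTheory.EllipticCurves.UniformizationProofs

/-!
# KontsevichZagierPeriods — class E1 per curve: the corpus's non-CM test curves as kernel theorems

Cell pub-kz1p (KZ 1-periods), seat b2b-kz1p-1, helper of the rung-1 item; continuation of
`KzOnePeriodsBakerClasses.lean`.  That file records the E1 transcendence inputs at CLASS level
(`∀ L : PeriodPair, … → ¬ L.HasCM → …`): Masser's Theorem II (`masser_ellipticPeriods_holds`), the seven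
1-periods of Huber–Wüstholz (`HuberWustholzOnePeriods_holds`) and the completeness statement HW Thm 13.3 (2)
for one non-CM elliptic curve with arbitrary paths (`CurvePeriods.huberWustholzCurvePeriods_weierCurve_puncturedLine`),
all PROVED in the tree.  What kept the cell's E1 `no relation` verdicts from being kernel theorems PER TEST
CURVE was the hypothesis `¬ L.HasCM` for a numerically given curve (packet GAPS.md G-K3: "no tree lemma
provides it").  This file supplies it, by the classical certificate the procedure itself uses (PROCEDURE §3,
CM test: "`j` non-integral ⇒ non-CM"):

* `not_hasCM_of_j_eq_ratCast` — if `j(Λ)` is a rational number that is not an integer, `Λ` has no complex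
  multiplication: the `j`-invariant of a CM lattice is an algebraic integer (Silverman, *Advanced Topics*,
  Thm II.6.1 (a) — the tree theorem `Literature.NumberTheory.EllipticCurves.isIntegral_int_j_of_hasCM`),
  and a rational algebraic integer is an integer (`ℤ` integrally closed);
* `j_eq_of_g₂_g₃` — `j(Λ) = 6912 A³ / (4A³ + 27B²)` when `g₂(Λ) = −4A`, `g₃(Λ) = −4B`, i.e. when
  `E_Λ` is the packet model `y² = x³ + Ax + B`;
* for the three non-CM curves of the corpus whose `j`-invariant is non-integral —
  `y² = x³ − 63x + 162 = (x+9)(x−3)(x−6)` (tests E1-04/05/06/07/09; `j = 148176/25`),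
  `y² = x³ − 73x + 72 = (x+9)(x−1)(x−8)` (E1-08/10/13/14/15/23; `j = 672221376/354025`),
  `y² = x³ − x + 1` (E1-24/28; `j = −6912/23`) — and EVERY period lattice `Λ` of the curve
  (one exists: `exists_periodPair_*`, the Uniformization Theorem `PeriodPair.uniformization_holds`):
  `not_hasCM_*` (no CM), `qbarLinearIndependent_periods_*` (`1, 2πi, ω₁, ω₂, η₁, η₂` are `ℚ̄`-linearly
  independent — the E1-04 verdict "dim W = 6", HW Thm 18.9 with `n = m = 0`, `e = 1`),
  `qbarLinearIndependent_periods_log_*` (the seven numbers `1, 2πi, log α, ω₁, ω₂, η₁, η₂` for algebraic `α`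
  not a root of unity, HW Thm 15.3 (1); instance `α = 2`), and `huberWustholzCurvePeriods_*` — HW Thm 13.3 (2)
  for period symbols supported on the curve, on punctured lines `Z_a`, on `𝔾ₘ` and on `𝔸¹` with ARBITRARY
  `C¹` paths with algebraic end points: every vanishing `ℚ̄`-linear combination of such periods (incomplete
  elliptic integrals of the first and second kind between algebraic points, logarithms, `1`) is elementary.
  For these test ids the packet hypothesis "HW Thm 13.3 (2)" is thereby a kernel theorem with NO residual
  side condition.

Not covered (unchanged): `y² = x³ − 3x + 1` (E1-27: `j = 2304` is an integer, the certificate does not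
apply), differentials of the third kind, CM curves with open paths.
[cite: HuberWustholz2022, Thm 13.3 (2) p.121; Thm 15.3 (1) p.145; Thm 18.9 p.179] [cite: Masser1975, Thm II]
[cite: SilvermanATAEC1994, Thm II.6.1]
-/

namespace Summit.KontsevichZagierPeriods.KzOnePeriods

open Literature.NumberTheory.Transcendental Literature.NumberTheory.Transcendental.CurvePeriods
open Literature.NumberTheory.EllipticCurves
open Complex MvPolynomial

/-! ### The CM certificate: non-integral rational `j` -/

/-- A rational number which, read in `ℂ`, is integral over `ℤ` is an integer (`ℤ` is integrally closed in
`ℚ = Frac ℤ`). [folklore] -/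
theorem exists_intCast_eq_of_isIntegral_ratCast {q : ℚ} (h : IsIntegral ℤ ((q : ℚ) : ℂ)) :
    ∃ n : ℤ, (n : ℚ) = q := by
  have h' : IsIntegral ℤ q := IsIntegral.tower_bot_of_field (A := ℚ) (B := ℂ) h
  obtain ⟨n, hn⟩ := IsIntegrallyClosed.algebraMap_eq_of_integral (R := ℤ) (K := ℚ) h'
  exact ⟨n, by simpa using hn⟩

/-- **CM test by the `j`-invariant.** If `j(Λ) = q ∈ ℚ` with `q ∉ ℤ`, the lattice `Λ` has no complex
multiplication: for a CM lattice `j(Λ)` is an algebraic integer (Silverman, *Advanced Topics*, Thm II.6.1 (a);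
tree theorem `isIntegral_int_j_of_hasCM`). [cite: SilvermanATAEC1994, Thm II.6.1] -/
theorem not_hasCM_of_j_eq_ratCast (L : PeriodPair) {q : ℚ} (hj : L.j = (q : ℂ))
    (hq : ∀ n : ℤ, (n : ℚ) ≠ q) : ¬ L.HasCM := by
  intro hCM
  have hint : IsIntegral ℤ ((q : ℚ) : ℂ) := hj ▸ isIntegral_int_j_of_hasCM hCM
  obtain ⟨n, hn⟩ := exists_intCast_eq_of_isIntegral_ratCast hint
  exact hq n hn

/-- `j(Λ) = 6912 A³ / (4A³ + 27B²)` for a lattice with `g₂(Λ) = −4A`, `g₃(Λ) = −4B` (the lattice of the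
packet model `y² = x³ + Ax + B`; `j = 1728 g₂³/(g₂³ − 27g₃²)`). [folklore] -/
theorem j_eq_of_g₂_g₃ (L : PeriodPair) {A B : ℂ} (h₂ : L.g₂ = -4 * A) (h₃ : L.g₃ = -4 * B) :
    L.j = 6912 * A ^ 3 / (4 * A ^ 3 + 27 * B ^ 2) := by
  have hΔ : L.g₂ ^ 3 - 27 * L.g₃ ^ 2 ≠ 0 := L.discr_ne_zero
  have hD : 4 * A ^ 3 + 27 * B ^ 2 ≠ 0 := by
    intro h0
    apply hΔ
    rw [h₂, h₃]
    linear_combination (-16 : ℂ) * h0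
  rw [PeriodPair.j_def, h₂, h₃, div_eq_div_iff (by rw [← h₂, ← h₃]; exact hΔ) hD]
  ring

/-- The invariants `g₂ = −4A`, `g₃ = −4B` are algebraic when `A, B` are integers. [folklore] -/
theorem isAlgebraic_g₂_g₃_of_eq (L : PeriodPair) {a b : ℤ} (h₂ : L.g₂ = -4 * (a : ℂ))
    (h₃ : L.g₃ = -4 * (b : ℂ)) : IsAlgebraic ℚ L.g₂ ∧ IsAlgebraic ℚ L.g₃ := by
  constructor
  · rw [h₂]; exact ((isAlgebraic_int 4).neg).mul (isAlgebraic_int a)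
  · rw [h₃]; exact ((isAlgebraic_int 4).neg).mul (isAlgebraic_int b)

/-- `2` is not a root of unity. [folklore] -/
theorem two_pow_ne_one (n : ℕ) (hn : 0 < n) : (2 : ℂ) ^ n ≠ 1 := by
  have h : (1 : ℝ) < 2 ^ n := one_lt_pow₀ (by norm_num) hn.ne'
  intro h1
  have h2 : ((2 ^ n : ℝ) : ℂ) = 1 := by push_cast; exact h1
  have h3 : (2 : ℝ) ^ n = 1 := by exact_mod_cast h2
  linarith

/-! ### A uniform package: everything the three curves need from `¬ CM` -/

/-- For a lattice `Λ` with `g₂ = −4a`, `g₃ = −4b` (`a, b ∈ ℤ`) and WITHOUT complex multiplication: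
(1) `1, 2πi, ω₁, ω₂, η₁, η₂` are `ℚ̄`-linearly independent (Masser 1975 Thm II, tree theorem
`masser_ellipticPeriods_holds`); (2) so are `1, 2πi, w, ω₁, ω₂, η₁, η₂` for any logarithm `w` of an algebraic
`α` that is not a root of unity (HW Thm 15.3 (1), tree theorem `HuberWustholzOnePeriods_holds`).
[cite: Masser1975, Thm II] [cite: HuberWustholz2022, Thm 15.3 (1) p.145] -/
theorem periods_independent_of_not_hasCM (L : PeriodPair) {a b : ℤ} (h₂ : L.g₂ = -4 * (a : ℂ))
    (h₃ : L.g₃ = -4 * (b : ℂ)) (hCM : ¬ L.HasCM) :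
    QbarLinearIndependent ![1, 2 * Real.pi * I, L.ω₁, L.ω₂, L.η₁, L.η₂] ∧
      ∀ (α w : ℂ), IsAlgebraic ℚ α → (∀ n : ℕ, 0 < n → α ^ n ≠ 1) → exp w = α →
        QbarLinearIndependent ![1, 2 * Real.pi * I, w, L.ω₁, L.ω₂, L.η₁, L.η₂] := by
  obtain ⟨hg₂, hg₃⟩ := isAlgebraic_g₂_g₃_of_eq L h₂ h₃
  exact ⟨masser_ellipticPeriods_holds L hg₂ hg₃ hCM,
    fun α w hα hroot hw => HuberWustholzOnePeriods_holds L hg₂ hg₃ hCM α w hα hroot hw⟩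

/-! ### `E : y² = x³ − 63x + 162 = (x + 9)(x − 3)(x − 6)` (tests E1-04, 05, 06, 07, 09) -/

/-- `j(E) = 148176/25` for every period lattice of `y² = x³ − 63x + 162`. [folklore] -/
theorem j_curve_63_162 (L : PeriodPair) (h₂ : L.g₂ = -4 * ((-63 : ℤ) : ℂ))
    (h₃ : L.g₃ = -4 * ((162 : ℤ) : ℂ)) : L.j = ((148176 / 25 : ℚ) : ℂ) := by
  rw [j_eq_of_g₂_g₃ L h₂ h₃]
  push_cast
  norm_num

/-- `y² = x³ − 63x + 162` has no complex multiplication (`j = 148176/25 ∉ ℤ`). [folklore] -/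
theorem not_hasCM_curve_63_162 (L : PeriodPair) (h₂ : L.g₂ = -4 * ((-63 : ℤ) : ℂ))
    (h₃ : L.g₃ = -4 * ((162 : ℤ) : ℂ)) : ¬ L.HasCM := by
  refine not_hasCM_of_j_eq_ratCast L (j_curve_63_162 L h₂ h₃) fun n hn => ?_
  have h25 : (n : ℚ) * 25 = 148176 := by rw [hn]; norm_num
  have h25' : n * 25 = 148176 := by exact_mod_cast h25
  omega

/-- A period lattice of `y² = x³ − 63x + 162` exists (Uniformization Theorem, tree theorem
`PeriodPair.uniformization_holds`). [cite: SilvermanAEC2009, Thm VI.5.1] -/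
theorem exists_periodPair_curve_63_162 :
    ∃ L : PeriodPair, L.g₂ = -4 * ((-63 : ℤ) : ℂ) ∧ L.g₃ = -4 * ((162 : ℤ) : ℂ) :=
  PeriodPair.uniformization_holds _ _ (by push_cast; norm_num)

/-- **Test E1-04 as a kernel theorem** ("no relation; dim W = 6"): for every period lattice of
`y² = (x+9)(x−3)(x−6)`, the six numbers `1, 2πi, ω₁, ω₂, η₁, η₂` are linearly independent over `ℚ̄`
(Masser Thm II = HW Thm 18.9 with `n = m = 0`, `e = 1`; no CM by `not_hasCM_curve_63_162`).
[cite: Masser1975, Thm II] [cite: HuberWustholz2022, Thm 18.9 p.179] -/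
theorem qbarLinearIndependent_periods_curve_63_162 (L : PeriodPair)
    (h₂ : L.g₂ = -4 * ((-63 : ℤ) : ℂ)) (h₃ : L.g₃ = -4 * ((162 : ℤ) : ℂ)) :
    QbarLinearIndependent ![1, 2 * Real.pi * I, L.ω₁, L.ω₂, L.η₁, L.η₂] :=
  (periods_independent_of_not_hasCM L h₂ h₃ (not_hasCM_curve_63_162 L h₂ h₃)).1

/-- The seven 1-periods `1, 2πi, w, ω₁, ω₂, η₁, η₂` of `y² = x³ − 63x + 162` and a Kummer motive
`[ℤ → 𝔾ₘ], 1 ↦ α` (`α ∈ ℚ̄` not a root of unity, `exp w = α`) are `ℚ̄`-linearly independent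
(HW Thm 15.3 (1), `δ = 7`). [cite: HuberWustholz2022, Thm 15.3 (1) p.145] -/
theorem qbarLinearIndependent_periods_log_curve_63_162 (L : PeriodPair)
    (h₂ : L.g₂ = -4 * ((-63 : ℤ) : ℂ)) (h₃ : L.g₃ = -4 * ((162 : ℤ) : ℂ))
    (α w : ℂ) (hα : IsAlgebraic ℚ α) (hroot : ∀ n : ℕ, 0 < n → α ^ n ≠ 1) (hw : exp w = α) :
    QbarLinearIndependent ![1, 2 * Real.pi * I, w, L.ω₁, L.ω₂, L.η₁, L.η₂] :=
  (periods_independent_of_not_hasCM L h₂ h₃ (not_hasCM_curve_63_162 L h₂ h₃)).2 α w hα hroot hw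

/-- Instance `α = 2`: `1, 2πi, log 2, ω₁, ω₂, η₁, η₂` of `y² = x³ − 63x + 162` are `ℚ̄`-linearly
independent. [cite: HuberWustholz2022, Thm 15.3 (1) p.145] -/
theorem qbarLinearIndependent_periods_log_two_curve_63_162 (L : PeriodPair)
    (h₂ : L.g₂ = -4 * ((-63 : ℤ) : ℂ)) (h₃ : L.g₃ = -4 * ((162 : ℤ) : ℂ)) :
    QbarLinearIndependent ![1, 2 * Real.pi * I, log 2, L.ω₁, L.ω₂, L.η₁, L.η₂] :=
  qbarLinearIndependent_periods_log_curve_63_162 L h₂ h₃ 2 (log 2) (isAlgebraic_int 2)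
    two_pow_ne_one (by rw [exp_log two_ne_zero])

/-- **HW Thm 13.3 (2) for `y² = x³ − 63x + 162` with ARBITRARY paths — kernel theorem, no residual
hypothesis**: for every period lattice `Λ` of the curve, every vanishing `ℚ̄`-linear combination of period
symbols supported on `E_{−63,162}`, on punctured lines `Z_a = {y ∏ (x − aᵢ) = 1}` (`a` injective,
algebraic), on `𝔾ₘ = {xy = 1}` and on `𝔸¹`, with `C¹` paths with algebraic end points, is a
`ℚ̄`-combination of the elementary relations (R1)–(R5) (tests E1-05/06/07/09: incomplete integrals of
the first and second kind, elliptic logarithms of `ℚ`-points, torsion end points, plus logarithms).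
[cite: HuberWustholz2022, Thm 13.3 (2) p.121] -/
theorem huberWustholzCurvePeriods_curve_63_162 (L : PeriodPair)
    (h₂ : L.g₂ = -4 * ((-63 : ℤ) : ℂ)) (h₃ : L.g₃ = -4 * ((162 : ℤ) : ℂ))
    (c : PeriodSymbol →₀ ℂ) (hc : ∀ s, IsAlgebraic ℚ (c s))
    (hsupp : ∀ s ∈ c.support,
      (∃ (r : ℕ) (a : Fin r → ℂ), Function.Injective a ∧ (∀ i, IsAlgebraic ℚ (a i)) ∧
        s.Z = (⟨2, 1, ![X 1 * ∏ i, (X 0 - C (a i)) - 1]⟩ : CurveData)) ∨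
      s.Z = weierCurve ((-63 : ℤ) : ℂ) ((162 : ℤ) : ℂ) ∨
        s.Z = (⟨2, 1, ![X 0 * X 1 - 1]⟩ : CurveData) ∨ s.Z = CurveData.affineLine)
    (h0 : evalCombination c = 0) :
    ∃ (k : ℕ) (ρ : Fin k → (PeriodSymbol →₀ ℂ)) (a : Fin k → ℂ),
      (∀ l, IsElementaryRelation (ρ l)) ∧ (∀ l, IsAlgebraic ℚ (a l)) ∧ c = ∑ l, a l • ρ l :=
  huberWustholzCurvePeriods_weierCurve_puncturedLine L h₂ h₃ (isAlgebraic_int _) (isAlgebraic_int _)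
    (not_hasCM_curve_63_162 L h₂ h₃) c hc hsupp h0

/-! ### `E : y² = x³ − 73x + 72 = (x + 9)(x − 1)(x − 8)` (tests E1-08, 10, 13, 14, 15, 23) -/

/-- `j(E) = 672221376/354025` for every period lattice of `y² = x³ − 73x + 72`. [folklore] -/
theorem j_curve_73_72 (L : PeriodPair) (h₂ : L.g₂ = -4 * ((-73 : ℤ) : ℂ))
    (h₃ : L.g₃ = -4 * ((72 : ℤ) : ℂ)) : L.j = ((672221376 / 354025 : ℚ) : ℂ) := by
  rw [j_eq_of_g₂_g₃ L h₂ h₃]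
  push_cast
  norm_num

/-- `y² = x³ − 73x + 72` has no complex multiplication (`j = 672221376/354025 ∉ ℤ`; `354025 = 5²·7²·17²`,
`672221376 = 2⁶·3³·73³`). [folklore] -/
theorem not_hasCM_curve_73_72 (L : PeriodPair) (h₂ : L.g₂ = -4 * ((-73 : ℤ) : ℂ))
    (h₃ : L.g₃ = -4 * ((72 : ℤ) : ℂ)) : ¬ L.HasCM := by
  refine not_hasCM_of_j_eq_ratCast L (j_curve_73_72 L h₂ h₃) fun n hn => ?_
  have h' : (n : ℚ) * 354025 = 672221376 := by rw [hn]; norm_num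
  have h'' : n * 354025 = 672221376 := by exact_mod_cast h'
  omega

/-- A period lattice of `y² = x³ − 73x + 72` exists (Uniformization Theorem).
[cite: SilvermanAEC2009, Thm VI.5.1] -/
theorem exists_periodPair_curve_73_72 :
    ∃ L : PeriodPair, L.g₂ = -4 * ((-73 : ℤ) : ℂ) ∧ L.g₃ = -4 * ((72 : ℤ) : ℂ) :=
  PeriodPair.uniformization_holds _ _ (by push_cast; norm_num)

/-- For every period lattice of `y² = (x+9)(x−1)(x−8)`: `1, 2πi, ω₁, ω₂, η₁, η₂` are `ℚ̄`-linearly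
independent (Masser Thm II; the `n = m = 0` part of the E1-08 / E1-10 counts).
[cite: Masser1975, Thm II] [cite: HuberWustholz2022, Thm 18.9 p.179] -/
theorem qbarLinearIndependent_periods_curve_73_72 (L : PeriodPair)
    (h₂ : L.g₂ = -4 * ((-73 : ℤ) : ℂ)) (h₃ : L.g₃ = -4 * ((72 : ℤ) : ℂ)) :
    QbarLinearIndependent ![1, 2 * Real.pi * I, L.ω₁, L.ω₂, L.η₁, L.η₂] :=
  (periods_independent_of_not_hasCM L h₂ h₃ (not_hasCM_curve_73_72 L h₂ h₃)).1

/-- The seven 1-periods `1, 2πi, w, ω₁, ω₂, η₁, η₂` of `y² = x³ − 73x + 72` and `[ℤ → 𝔾ₘ], 1 ↦ α`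
(`α ∈ ℚ̄` not a root of unity, `exp w = α`) are `ℚ̄`-linearly independent (HW Thm 15.3 (1)).
[cite: HuberWustholz2022, Thm 15.3 (1) p.145] -/
theorem qbarLinearIndependent_periods_log_curve_73_72 (L : PeriodPair)
    (h₂ : L.g₂ = -4 * ((-73 : ℤ) : ℂ)) (h₃ : L.g₃ = -4 * ((72 : ℤ) : ℂ))
    (α w : ℂ) (hα : IsAlgebraic ℚ α) (hroot : ∀ n : ℕ, 0 < n → α ^ n ≠ 1) (hw : exp w = α) :
    QbarLinearIndependent ![1, 2 * Real.pi * I, w, L.ω₁, L.ω₂, L.η₁, L.η₂] :=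
  (periods_independent_of_not_hasCM L h₂ h₃ (not_hasCM_curve_73_72 L h₂ h₃)).2 α w hα hroot hw

/-- **HW Thm 13.3 (2) for `y² = x³ − 73x + 72` with ARBITRARY paths — kernel theorem, no residual
hypothesis** (first and second kind on the curve, punctured lines, `𝔾ₘ`, `𝔸¹`; tests E1-10/13/14/15 —
the third-kind tests E1-08/23 on the same curve use `E` minus a point and are NOT covered).
[cite: HuberWustholz2022, Thm 13.3 (2) p.121] -/
theorem huberWustholzCurvePeriods_curve_73_72 (L : PeriodPair)
    (h₂ : L.g₂ = -4 * ((-73 : ℤ) : ℂ)) (h₃ : L.g₃ = -4 * ((72 : ℤ) : ℂ))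
    (c : PeriodSymbol →₀ ℂ) (hc : ∀ s, IsAlgebraic ℚ (c s))
    (hsupp : ∀ s ∈ c.support,
      (∃ (r : ℕ) (a : Fin r → ℂ), Function.Injective a ∧ (∀ i, IsAlgebraic ℚ (a i)) ∧
        s.Z = (⟨2, 1, ![X 1 * ∏ i, (X 0 - C (a i)) - 1]⟩ : CurveData)) ∨
      s.Z = weierCurve ((-73 : ℤ) : ℂ) ((72 : ℤ) : ℂ) ∨
        s.Z = (⟨2, 1, ![X 0 * X 1 - 1]⟩ : CurveData) ∨ s.Z = CurveData.affineLine)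
    (h0 : evalCombination c = 0) :
    ∃ (k : ℕ) (ρ : Fin k → (PeriodSymbol →₀ ℂ)) (a : Fin k → ℂ),
      (∀ l, IsElementaryRelation (ρ l)) ∧ (∀ l, IsAlgebraic ℚ (a l)) ∧ c = ∑ l, a l • ρ l :=
  huberWustholzCurvePeriods_weierCurve_puncturedLine L h₂ h₃ (isAlgebraic_int _) (isAlgebraic_int _)
    (not_hasCM_curve_73_72 L h₂ h₃) c hc hsupp h0

/-! ### `E : y² = x³ − x + 1` (one real root; tests E1-24, 28) -/

/-- `j(E) = −6912/23` for every period lattice of `y² = x³ − x + 1`. [folklore] -/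
theorem j_curve_1_1 (L : PeriodPair) (h₂ : L.g₂ = -4 * ((-1 : ℤ) : ℂ))
    (h₃ : L.g₃ = -4 * ((1 : ℤ) : ℂ)) : L.j = ((-6912 / 23 : ℚ) : ℂ) := by
  rw [j_eq_of_g₂_g₃ L h₂ h₃]
  push_cast
  norm_num

/-- `y² = x³ − x + 1` has no complex multiplication (`j = −6912/23 ∉ ℤ`). [folklore] -/
theorem not_hasCM_curve_1_1 (L : PeriodPair) (h₂ : L.g₂ = -4 * ((-1 : ℤ) : ℂ))
    (h₃ : L.g₃ = -4 * ((1 : ℤ) : ℂ)) : ¬ L.HasCM := by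
  refine not_hasCM_of_j_eq_ratCast L (j_curve_1_1 L h₂ h₃) fun n hn => ?_
  have h' : (n : ℚ) * 23 = -6912 := by rw [hn]; norm_num
  have h'' : n * 23 = -6912 := by exact_mod_cast h'
  omega

/-- A period lattice of `y² = x³ − x + 1` exists (Uniformization Theorem).
[cite: SilvermanAEC2009, Thm VI.5.1] -/
theorem exists_periodPair_curve_1_1 :
    ∃ L : PeriodPair, L.g₂ = -4 * ((-1 : ℤ) : ℂ) ∧ L.g₃ = -4 * ((1 : ℤ) : ℂ) :=
  PeriodPair.uniformization_holds _ _ (by push_cast; norm_num)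

/-- For every period lattice of `y² = x³ − x + 1`: `1, 2πi, ω₁, ω₂, η₁, η₂` are `ℚ̄`-linearly independent
(Masser Thm II; the `n = m = 0` part of the E1-28 count). [cite: Masser1975, Thm II]
[cite: HuberWustholz2022, Thm 18.9 p.179] -/
theorem qbarLinearIndependent_periods_curve_1_1 (L : PeriodPair)
    (h₂ : L.g₂ = -4 * ((-1 : ℤ) : ℂ)) (h₃ : L.g₃ = -4 * ((1 : ℤ) : ℂ)) :
    QbarLinearIndependent ![1, 2 * Real.pi * I, L.ω₁, L.ω₂, L.η₁, L.η₂] :=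
  (periods_independent_of_not_hasCM L h₂ h₃ (not_hasCM_curve_1_1 L h₂ h₃)).1

/-- The seven 1-periods `1, 2πi, w, ω₁, ω₂, η₁, η₂` of `y² = x³ − x + 1` and `[ℤ → 𝔾ₘ], 1 ↦ α`
(`α ∈ ℚ̄` not a root of unity, `exp w = α`) are `ℚ̄`-linearly independent (HW Thm 15.3 (1)).
[cite: HuberWustholz2022, Thm 15.3 (1) p.145] -/
theorem qbarLinearIndependent_periods_log_curve_1_1 (L : PeriodPair)
    (h₂ : L.g₂ = -4 * ((-1 : ℤ) : ℂ)) (h₃ : L.g₃ = -4 * ((1 : ℤ) : ℂ))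
    (α w : ℂ) (hα : IsAlgebraic ℚ α) (hroot : ∀ n : ℕ, 0 < n → α ^ n ≠ 1) (hw : exp w = α) :
    QbarLinearIndependent ![1, 2 * Real.pi * I, w, L.ω₁, L.ω₂, L.η₁, L.η₂] :=
  (periods_independent_of_not_hasCM L h₂ h₃ (not_hasCM_curve_1_1 L h₂ h₃)).2 α w hα hroot hw

/-- **HW Thm 13.3 (2) for `y² = x³ − x + 1` with ARBITRARY paths — kernel theorem, no residual
hypothesis** (test E1-24: elliptic logarithms of `ℚ`-points on a one-real-root curve, plus logarithms; the
third-kind test E1-28 is NOT covered). [cite: HuberWustholz2022, Thm 13.3 (2) p.121] -/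
theorem huberWustholzCurvePeriods_curve_1_1 (L : PeriodPair)
    (h₂ : L.g₂ = -4 * ((-1 : ℤ) : ℂ)) (h₃ : L.g₃ = -4 * ((1 : ℤ) : ℂ))
    (c : PeriodSymbol →₀ ℂ) (hc : ∀ s, IsAlgebraic ℚ (c s))
    (hsupp : ∀ s ∈ c.support,
      (∃ (r : ℕ) (a : Fin r → ℂ), Function.Injective a ∧ (∀ i, IsAlgebraic ℚ (a i)) ∧
        s.Z = (⟨2, 1, ![X 1 * ∏ i, (X 0 - C (a i)) - 1]⟩ : CurveData)) ∨
      s.Z = weierCurve ((-1 : ℤ) : ℂ) ((1 : ℤ) : ℂ) ∨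
        s.Z = (⟨2, 1, ![X 0 * X 1 - 1]⟩ : CurveData) ∨ s.Z = CurveData.affineLine)
    (h0 : evalCombination c = 0) :
    ∃ (k : ℕ) (ρ : Fin k → (PeriodSymbol →₀ ℂ)) (a : Fin k → ℂ),
      (∀ l, IsElementaryRelation (ρ l)) ∧ (∀ l, IsAlgebraic ℚ (a l)) ∧ c = ∑ l, a l • ρ l :=
  huberWustholzCurvePeriods_weierCurve_puncturedLine L h₂ h₃ (isAlgebraic_int _) (isAlgebraic_int _)
    (not_hasCM_curve_1_1 L h₂ h₃) c hc hsupp h0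

end Summit.KontsevichZagierPeriods.KzOnePeriods
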